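import Mathlib
import HarnessLib
import Summits.HubbardSuperconductivity.HubbardSuperconductivity.Theorems.KLProgrammeC4aKeyLemmaCooper
import Summits.HubbardSuperconductivity.HubbardSuperconductivity.Theorems.KLProgrammeC4aUmkDirectLevelLine
import Summits.HubbardSuperconductivity.HubbardSuperconductivity.Theorems.KLProgrammeC4aPartnerBandCooperChord

/-!
# Route `KLProgramme` — crux C4a, S3 brick (B4) «(U1)-HYBRID» part D-3d: THE DIRECT COOPER PART OF THE FIRST-ORDER LAYER ON ONE LEVEL LINE — the key lemma near Cooper
# (D-3c) feeds `…C4aUmkDirectLevelLine.directPart_levelLine_abs_le`; the support of the Cooper cut-off is placed in the Cooper window by the chord bound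

Cell `gate-hubbard-kl`, seat hubbard-kl-k3c3-p3 (g37; row «implicit-function / monotonicity route for μ(n)»).  Located brick for the (C)-closer lane / the (M4)
assembly of the first-order ϑ-layer (stub (C) `stub_twoLeg_curvature` of `KLRegimeEngineV17F2`, stmt-HubbardSuperconductivity-20437), memo
HOME/hubbard-kl-k3c3-p3/U1-CAUSTIC-SUP.md §19 addendum (c) «D-3»; the Cooper twin of `…C4aUmkDirectTangencyLine` (D-2c).

WHY.  The direct-sheet COOPER part of the hybrid split (numerator `c·J·G` with the cut-off `c` supported in the Cooper class `‖S(ϑ)‖ ≤ s₁`, `S = Φ(0,θ) + Φ(ρ,ϑ+θ)`) is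
counted in the co-moving currency by `directPart_levelLine_abs_le` once its `hkey` row — the KEY LEMMA `|𝒜_φ| ≤ C₁|ē| + C₂|e| + C₃|ρ|` on the support of `c` — is supplied.
`…C4aKeyLemmaCooper.abs_baseDeriv_partnerBand_pp_le_band_distance_cooper` gives it on the WHOLE loop circle for every configuration of the Cooper window `‖ϑ − π‖_𝕋 ≤ η₀`
with `η`-free constants; and the support is placed in that window by the chord bound `(2u_min/π)‖ϑ − π‖_𝕋 ≤ ‖S‖` (`…C4aPartnerBandCooperChord.torusDist_sub_pi_le_norm_pairSum`)
under the row `(π/(2u_min))·s₁ ≤ η₀` (the consumer's cut-off radius `s₁` is free).  No restriction on `ϑ` (outside the window the cut-off vanishes and the row is void).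
* **`directCooper_levelLine_abs_le`** (HEADLINE): for every `ϑ`, `|e| < r`, `|ρ| < r`, the loop circle `[−π, π]`:
  `|∫ c·J·G·(K e)′(ē)| ≤ (J₀(Q + C|e|/m + C|ρ|/m) + B_cJ₀ + J₁)·∫ (max m |ē|)⁻¹` with D-3c's `Q = max(H₁₀/(G/2), H₀₀/(Gδ₀/4))`, `C = Q𝒦Re + 2𝒦ReDe`.
What is left above it: the level/`ϑ` layers = the `k = 0` dominator of B4-DIRECT-PACK over the Cooper class (`absBubble_partnerBand_le_posLog[_neg]`), exactly as for D-2c.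
Sizes binder shape + clause (i) `GeomConstants` of `FrameOK`; nothing asserts (C), K3 or superconductivity.
References: FST II CPAM 51 (1998) §3 [cite: FeldmanSalmhoferTrubowitz1998]; BGM 2003 §7.1 [cite: BenfattoGiulianiMastropietro2003]; BGM 2006 §2.4 [cite: BenfattoGiulianiMastropietro2006].
-/

noncomputable section

namespace Summit.HubbardSuperconductivity.HubbardSuperconductivity.Theorems.C4a

set_option linter.dupNamespace false -- summit = problem name (single-conjunct summit), D-0017

open Real Set Filter MeasureTheory intervalIntegral
open scoped Topology
open Literature.MathematicalPhysics.QuantumLattice Literature.MathematicalPhysics.QuantumLattice.BandSectorCounting Literature.Probability.LatticeModels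
open Literature.MathematicalPhysics.QuantumLattice.FermiRG
open Summit.HubbardSuperconductivity.HubbardSuperconductivity.Theorems.KLRegimeSplit
open Summit.HubbardSuperconductivity.HubbardSuperconductivity.Theorems.DispersionFlow
open Summit.HubbardSuperconductivity.HubbardSuperconductivity.Theorems.PerturbedFermiCurve

section Sizes

variable {K : TrigPolyC4v} {A : ℝ} (hA : ∀ p : Momentum, ∀ j ≤ 2, ‖iteratedFDeriv ℝ j (frameShift K) p‖ ≤ A) (hA20 : A ≤ 1 / 20)
  (hd : klCurveD ≤ (bandBounds (show (-4 : ℝ) < -1.1 by norm_num) (show (-1.1 : ℝ) ≤ -0.1 by norm_num)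
    (show (-0.1 : ℝ) < 0 by norm_num)).Dtmin - 2 * A)
  {μ r : ℝ} (hr : 0 < r) (hlo : (-1.1 : ℝ) < μ - r - A) (hhi : μ + r + A < -0.1)
  {A₃ A₄ A₅ A₆ : ℝ} (hA₃ : ∀ p : Momentum, ‖iteratedFDeriv ℝ 3 (frameShift K) p‖ ≤ A₃)
  (hA₄ : ∀ p : Momentum, ‖iteratedFDeriv ℝ 4 (frameShift K) p‖ ≤ A₄)
  (hA₅ : ∀ p : Momentum, ‖iteratedFDeriv ℝ 5 (frameShift K) p‖ ≤ A₅)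
  (hA₆ : ∀ p : Momentum, ‖iteratedFDeriv ℝ 6 (frameShift K) p‖ ≤ A₆)
  {K₁ K₂ K₃ : ℝ} (hK₁ : ∀ p : Momentum, ‖fderiv ℝ (frameLevel μ K) p‖ ≤ K₁) (hK₂ : ∀ p : Momentum, ‖iteratedFDeriv ℝ 2 (frameLevel μ K) p‖ ≤ K₂)
  (hK₃ : ∀ p : Momentum, ‖iteratedFDeriv ℝ 3 (frameLevel μ K) p‖ ≤ K₃)
include hA hA20 hd hr hlo hhi hA₃ hA₄ hA₅ hA₆ hK₁ hK₂ hK₃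

/-- **THE DIRECT COOPER PART, ONE LEVEL LINE** (HEADLINE; see the module docstring): thresholds `0 < δ₀ ≤ π/2`, `(K₃msD₁² + K₂msD₂)msD₁δ₀ ≤ G/2`, `η₀ ≤ δ₀/2`,
`(K₁msD₂ + K₂msD₁²)η₀ ≤ Gδ₀/4`, support row `(π/(2u_min))·s₁ ≤ η₀`; cut-off `c ∈ C¹`, `|c| ≤ 1`, `|c′| ≤ B_c`, `2π`-periodic, vanishing when `‖S‖ > s₁`; factor `J`;
kernel envelopes `(max m |u|)⁻¹`, `(max m |u|)⁻²`. [cite: BenfattoGiulianiMastropietro2006, §2.4 Lemma 2.1] -/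
theorem directCooper_levelLine_abs_le {Kc r₀ g₀ w : ℝ} (hG : GeomConstants (frameLevel μ K) Kc r₀ g₀ w) {δ₀ η₀ s₁ : ℝ}
    (hδ₀ : 0 < δ₀) (hδ₀π : δ₀ ≤ π / 2)
    (hδrow : (K₃ * msD A₃ A₄ 1 ^ 2 + K₂ * msD A₃ A₄ 2) * msD A₃ A₄ 1 * δ₀ ≤
      (2 / π * (((bandBounds (show (-4 : ℝ) < -1.1 by norm_num) (show (-1.1 : ℝ) ≤ -0.1 by norm_num) (show (-0.1 : ℝ) < 0 by norm_num)).Dtmin - 2 * A) *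
        (bandBounds (show (-4 : ℝ) < -1.1 by norm_num) (show (-1.1 : ℝ) ≤ -0.1 by norm_num) (show (-0.1 : ℝ) < 0 by norm_num)).umin) *
        ((bandBounds (show (-4 : ℝ) < -1.1 by norm_num) (show (-1.1 : ℝ) ≤ -0.1 by norm_num) (show (-0.1 : ℝ) < 0 by norm_num)).umin * w / (4 + 2 * A))) / 2)
    (hη₀ : η₀ ≤ δ₀ / 2)
    (hη₀row : (K₁ * msD A₃ A₄ 2 + K₂ * msD A₃ A₄ 1 ^ 2) * η₀ ≤
      (2 / π * (((bandBounds (show (-4 : ℝ) < -1.1 by norm_num) (show (-1.1 : ℝ) ≤ -0.1 by norm_num) (show (-0.1 : ℝ) < 0 by norm_num)).Dtmin - 2 * A) *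
        (bandBounds (show (-4 : ℝ) < -1.1 by norm_num) (show (-1.1 : ℝ) ≤ -0.1 by norm_num) (show (-0.1 : ℝ) < 0 by norm_num)).umin) *
        ((bandBounds (show (-4 : ℝ) < -1.1 by norm_num) (show (-1.1 : ℝ) ≤ -0.1 by norm_num) (show (-0.1 : ℝ) < 0 by norm_num)).umin * w / (4 + 2 * A))) * δ₀ / 4)
    (hs₁ : π / (2 * (bandBounds (show (-4 : ℝ) < -1.1 by norm_num) (show (-1.1 : ℝ) ≤ -0.1 by norm_num) (show (-0.1 : ℝ) < 0 by norm_num)).umin) * s₁ ≤ η₀)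
    (ϑ θ : ℝ) {ρ e : ℝ} (hρ : |ρ| < r) (he : |e| < r) {c J Kr : ℝ → ℝ} {Bc J₀ J₁ m : ℝ}
    (hc : ContDiff ℝ 1 c) (hcb : ∀ v, |c v| ≤ 1) (hc1 : ∀ v, |deriv c v| ≤ Bc) (hcper : ∀ v, c (v + 2 * π) = c v)
    (hcsupp : ∀ v, s₁ < ‖pairSumPath μ K ρ ϑ θ 0‖ → c v = 0)
    (hJ : ContDiff ℝ 1 J) (hJb : ∀ v, |J v| ≤ J₀) (hJ1 : ∀ v, |deriv J v| ≤ J₁) (hJper : ∀ v, J (v + 2 * π) = J v)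
    (hK : ContDiff ℝ 1 Kr) (hm : 0 < m) (hK0 : ∀ u, |Kr u| ≤ (max m |u|)⁻¹) (hK1 : ∀ u, |deriv Kr u| ≤ (max m |u|)⁻¹ ^ 2) :
    |∫ v in (-π)..π, c v * J v * ((fderiv ℝ (frameLevel μ K) (pairSumPath μ K ρ ϑ θ 0 - levelPoint μ K e (v + θ)))
        (iteratedDeriv 1 (levelPoint μ K 0) θ + iteratedDeriv 1 (levelPoint μ K ρ) (ϑ + θ)) *
        deriv Kr (frameLevel μ K (pairSumPath μ K ρ ϑ θ 0 - levelPoint μ K e (v + θ))))| ≤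
      (J₀ * (max ((K₂ * msD A₃ A₄ 1 * msD A₃ A₄ 2 + (K₃ * msD A₃ A₄ 1 ^ 2 + K₂ * msD A₃ A₄ 2) * msD A₃ A₄ 1) /
            ((2 / π * (((bandBounds (show (-4 : ℝ) < -1.1 by norm_num) (show (-1.1 : ℝ) ≤ -0.1 by norm_num) (show (-0.1 : ℝ) < 0 by norm_num)).Dtmin - 2 * A) *
        (bandBounds (show (-4 : ℝ) < -1.1 by norm_num) (show (-1.1 : ℝ) ≤ -0.1 by norm_num) (show (-0.1 : ℝ) < 0 by norm_num)).umin) *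
        ((bandBounds (show (-4 : ℝ) < -1.1 by norm_num) (show (-1.1 : ℝ) ≤ -0.1 by norm_num) (show (-0.1 : ℝ) < 0 by norm_num)).umin * w / (4 + 2 * A))) / 2))
          ((K₁ * msD A₃ A₄ 2 + K₂ * msD A₃ A₄ 1 * msD A₃ A₄ 1) /
            ((2 / π * (((bandBounds (show (-4 : ℝ) < -1.1 by norm_num) (show (-1.1 : ℝ) ≤ -0.1 by norm_num) (show (-0.1 : ℝ) < 0 by norm_num)).Dtmin - 2 * A) *
        (bandBounds (show (-4 : ℝ) < -1.1 by norm_num) (show (-1.1 : ℝ) ≤ -0.1 by norm_num) (show (-0.1 : ℝ) < 0 by norm_num)).umin) *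
        ((bandBounds (show (-4 : ℝ) < -1.1 by norm_num) (show (-1.1 : ℝ) ≤ -0.1 by norm_num) (show (-0.1 : ℝ) < 0 by norm_num)).umin * w / (4 + 2 * A))) * δ₀ / 4)) +
        (max ((K₂ * msD A₃ A₄ 1 * msD A₃ A₄ 2 + (K₃ * msD A₃ A₄ 1 ^ 2 + K₂ * msD A₃ A₄ 2) * msD A₃ A₄ 1) /
            ((2 / π * (((bandBounds (show (-4 : ℝ) < -1.1 by norm_num) (show (-1.1 : ℝ) ≤ -0.1 by norm_num) (show (-0.1 : ℝ) < 0 by norm_num)).Dtmin - 2 * A) *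
        (bandBounds (show (-4 : ℝ) < -1.1 by norm_num) (show (-1.1 : ℝ) ≤ -0.1 by norm_num) (show (-0.1 : ℝ) < 0 by norm_num)).umin) *
        ((bandBounds (show (-4 : ℝ) < -1.1 by norm_num) (show (-1.1 : ℝ) ≤ -0.1 by norm_num) (show (-0.1 : ℝ) < 0 by norm_num)).umin * w / (4 + 2 * A))) / 2))
          ((K₁ * msD A₃ A₄ 2 + K₂ * msD A₃ A₄ 1 * msD A₃ A₄ 1) /
            ((2 / π * (((bandBounds (show (-4 : ℝ) < -1.1 by norm_num) (show (-1.1 : ℝ) ≤ -0.1 by norm_num) (show (-0.1 : ℝ) < 0 by norm_num)).Dtmin - 2 * A) *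
        (bandBounds (show (-4 : ℝ) < -1.1 by norm_num) (show (-1.1 : ℝ) ≤ -0.1 by norm_num) (show (-0.1 : ℝ) < 0 by norm_num)).umin) *
        ((bandBounds (show (-4 : ℝ) < -1.1 by norm_num) (show (-1.1 : ℝ) ≤ -0.1 by norm_num) (show (-0.1 : ℝ) < 0 by norm_num)).umin * w / (4 + 2 * A))) * δ₀ / 4)) *
          ((max K₁ K₂) * max (1 / ((bandBounds (show (-4 : ℝ) < -1.1 by norm_num) (show (-1.1 : ℝ) ≤ -0.1 by norm_num) (show (-0.1 : ℝ) < 0 by norm_num)).Dtmin - 2 * A))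
            (radialRowOneConst A ((bandBounds (show (-4 : ℝ) < -1.1 by norm_num) (show (-1.1 : ℝ) ≤ -0.1 by norm_num) (show (-0.1 : ℝ) < 0 by norm_num)).Dtmin - 2 * A))) +
        2 * (max K₁ K₂) *
          max (1 / ((bandBounds (show (-4 : ℝ) < -1.1 by norm_num) (show (-1.1 : ℝ) ≤ -0.1 by norm_num) (show (-0.1 : ℝ) < 0 by norm_num)).Dtmin - 2 * A))
            (radialRowOneConst A ((bandBounds (show (-4 : ℝ) < -1.1 by norm_num) (show (-1.1 : ℝ) ≤ -0.1 by norm_num) (show (-0.1 : ℝ) < 0 by norm_num)).Dtmin - 2 * A)) *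
          (max 1 (3 * msD A₃ A₄ 1 + r * radialRowOneConst A ((bandBounds (show (-4 : ℝ) < -1.1 by norm_num) (show (-1.1 : ℝ) ≤ -0.1 by norm_num) (show (-0.1 : ℝ) < 0 by norm_num)).Dtmin - 2 * A)))) * (|e| / m) +
        (max ((K₂ * msD A₃ A₄ 1 * msD A₃ A₄ 2 + (K₃ * msD A₃ A₄ 1 ^ 2 + K₂ * msD A₃ A₄ 2) * msD A₃ A₄ 1) /
            ((2 / π * (((bandBounds (show (-4 : ℝ) < -1.1 by norm_num) (show (-1.1 : ℝ) ≤ -0.1 by norm_num) (show (-0.1 : ℝ) < 0 by norm_num)).Dtmin - 2 * A) *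
        (bandBounds (show (-4 : ℝ) < -1.1 by norm_num) (show (-1.1 : ℝ) ≤ -0.1 by norm_num) (show (-0.1 : ℝ) < 0 by norm_num)).umin) *
        ((bandBounds (show (-4 : ℝ) < -1.1 by norm_num) (show (-1.1 : ℝ) ≤ -0.1 by norm_num) (show (-0.1 : ℝ) < 0 by norm_num)).umin * w / (4 + 2 * A))) / 2))
          ((K₁ * msD A₃ A₄ 2 + K₂ * msD A₃ A₄ 1 * msD A₃ A₄ 1) /
            ((2 / π * (((bandBounds (show (-4 : ℝ) < -1.1 by norm_num) (show (-1.1 : ℝ) ≤ -0.1 by norm_num) (show (-0.1 : ℝ) < 0 by norm_num)).Dtmin - 2 * A) *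
        (bandBounds (show (-4 : ℝ) < -1.1 by norm_num) (show (-1.1 : ℝ) ≤ -0.1 by norm_num) (show (-0.1 : ℝ) < 0 by norm_num)).umin) *
        ((bandBounds (show (-4 : ℝ) < -1.1 by norm_num) (show (-1.1 : ℝ) ≤ -0.1 by norm_num) (show (-0.1 : ℝ) < 0 by norm_num)).umin * w / (4 + 2 * A))) * δ₀ / 4)) *
          ((max K₁ K₂) * max (1 / ((bandBounds (show (-4 : ℝ) < -1.1 by norm_num) (show (-1.1 : ℝ) ≤ -0.1 by norm_num) (show (-0.1 : ℝ) < 0 by norm_num)).Dtmin - 2 * A))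
            (radialRowOneConst A ((bandBounds (show (-4 : ℝ) < -1.1 by norm_num) (show (-1.1 : ℝ) ≤ -0.1 by norm_num) (show (-0.1 : ℝ) < 0 by norm_num)).Dtmin - 2 * A))) +
        2 * (max K₁ K₂) *
          max (1 / ((bandBounds (show (-4 : ℝ) < -1.1 by norm_num) (show (-1.1 : ℝ) ≤ -0.1 by norm_num) (show (-0.1 : ℝ) < 0 by norm_num)).Dtmin - 2 * A))
            (radialRowOneConst A ((bandBounds (show (-4 : ℝ) < -1.1 by norm_num) (show (-1.1 : ℝ) ≤ -0.1 by norm_num) (show (-0.1 : ℝ) < 0 by norm_num)).Dtmin - 2 * A)) *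
          (max 1 (3 * msD A₃ A₄ 1 + r * radialRowOneConst A ((bandBounds (show (-4 : ℝ) < -1.1 by norm_num) (show (-1.1 : ℝ) ≤ -0.1 by norm_num) (show (-0.1 : ℝ) < 0 by norm_num)).Dtmin - 2 * A)))) * (|ρ| / m)) + (Bc * J₀ + J₁)) *
        ∫ v in (-π)..π, (max m |frameLevel μ K (pairSumPath μ K ρ ϑ θ 0 - levelPoint μ K e (v + θ))|)⁻¹ := by
  set B := (bandBounds (show (-4 : ℝ) < -1.1 by norm_num) (show (-1.1 : ℝ) ≤ -0.1 by norm_num) (show (-0.1 : ℝ) < 0 by norm_num)) with hBdef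
  set G : ℝ := 2 / π * ((B.Dtmin - 2 * A) * B.umin) * (B.umin * w / (4 + 2 * A)) with hGdef
  set H₁₀ : ℝ := (K₂ * msD A₃ A₄ 1 * msD A₃ A₄ 2 + (K₃ * msD A₃ A₄ 1 ^ 2 + K₂ * msD A₃ A₄ 2) * msD A₃ A₄ 1) with hH₁₀
  set H₀₀ : ℝ := (K₁ * msD A₃ A₄ 2 + K₂ * msD A₃ A₄ 1 * msD A₃ A₄ 1) with hH₀₀
  have hπ := Real.pi_pos
  have h0 : |(0 : ℝ)| < r := by simpa using hr
  have hADt : 2 * A < B.Dtmin := by have := klCurveD_pos; linarith only [this, hd]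
  have hDt : 0 < B.Dtmin - 2 * A := by linarith only [hADt]
  have hA0 : 0 ≤ A := le_trans (norm_nonneg _) (hA 0 0 (by norm_num))
  have hu : 0 < B.umin := B.umin_pos
  have hGpos : 0 < G :=
    mul_pos (mul_pos (by positivity) (mul_pos hDt B.umin_pos)) (by have := B.umin_pos; have := hG.wmin_pos; positivity)
  have hK₁0 : 0 ≤ K₁ := (norm_nonneg _).trans (hK₁ 0)
  have hK₂0 : 0 ≤ K₂ := (norm_nonneg _).trans (hK₂ 0)
  have hK₃0 : 0 ≤ K₃ := (norm_nonneg _).trans (hK₃ 0)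
  have hD1 : 0 ≤ msD A₃ A₄ 1 := (msD_one_pos A₃ A₄).le
  have hD2 : 0 ≤ msD A₃ A₄ 2 := (norm_nonneg _).trans (norm_iteratedDeriv_levelPoint_le hA hA20 hd hlo hhi hA₃ hA₄ h0 (i := 2) (by norm_num) (by norm_num) 0)
  have hH₁₀0 : 0 ≤ H₁₀ := by positivity
  have hQ0 : 0 ≤ max (H₁₀ / (G / 2)) (H₀₀ / (G * δ₀ / 4)) := le_max_of_le_left (by positivity)
  have h𝒦0 : 0 ≤ max K₁ K₂ := le_trans hK₁0 (le_max_left _ _)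
  have hRR0 : 0 ≤ radialRowOneConst A (B.Dtmin - 2 * A) := radialRowOneConst_nonneg hA0 hDt
  have hRe0 : 0 ≤ max (1 / (B.Dtmin - 2 * A)) (radialRowOneConst A (B.Dtmin - 2 * A)) := le_trans (by positivity) (le_max_left _ _)
  have hDe0 : 0 ≤ (max 1 (3 * msD A₃ A₄ 1 + r * radialRowOneConst A (B.Dtmin - 2 * A))) := zero_le_one.trans (le_max_left _ _)
  have hC0 : 0 ≤ max (H₁₀ / (G / 2)) (H₀₀ / (G * δ₀ / 4)) * ((max K₁ K₂) * max (1 / (B.Dtmin - 2 * A)) (radialRowOneConst A (B.Dtmin - 2 * A))) +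
      2 * (max K₁ K₂) * max (1 / (B.Dtmin - 2 * A)) (radialRowOneConst A (B.Dtmin - 2 * A)) *
        (max 1 (3 * msD A₃ A₄ 1 + r * radialRowOneConst A (B.Dtmin - 2 * A))) := by positivity
  refine directPart_levelLine_abs_le hA hd hr hlo hhi hρ he ϑ θ (C₁ := max (H₁₀ / (G / 2)) (H₀₀ / (G * δ₀ / 4)))
    (C₂ := max (H₁₀ / (G / 2)) (H₀₀ / (G * δ₀ / 4)) * ((max K₁ K₂) * max (1 / (B.Dtmin - 2 * A)) (radialRowOneConst A (B.Dtmin - 2 * A))) +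
      2 * (max K₁ K₂) * max (1 / (B.Dtmin - 2 * A)) (radialRowOneConst A (B.Dtmin - 2 * A)) *
        (max 1 (3 * msD A₃ A₄ 1 + r * radialRowOneConst A (B.Dtmin - 2 * A))))
    (C₃ := max (H₁₀ / (G / 2)) (H₀₀ / (G * δ₀ / 4)) * ((max K₁ K₂) * max (1 / (B.Dtmin - 2 * A)) (radialRowOneConst A (B.Dtmin - 2 * A))) +
      2 * (max K₁ K₂) * max (1 / (B.Dtmin - 2 * A)) (radialRowOneConst A (B.Dtmin - 2 * A)) *
        (max 1 (3 * msD A₃ A₄ 1 + r * radialRowOneConst A (B.Dtmin - 2 * A))))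
    hc hcb hc1 hcper hJ hJb hJ1 hJper hK hm hK0 hK1 hQ0 hC0 hC0 ?_
  intro v hcv
  -- the support sits in the Cooper window
  have hSle : ‖pairSumPath μ K ρ ϑ θ 0‖ ≤ s₁ := (lt_or_ge s₁ ‖pairSumPath μ K ρ ϑ θ 0‖).resolve_left fun h => hcv (hcsupp v h)
  have hch := torusDist_sub_pi_le_norm_pairSum hA hr hlo hhi hρ ϑ θ
  have hϑ : torusDist (ϑ - π) ≤ η₀ := by
    have h1 : 2 * B.umin / π * torusDist (ϑ - π) ≤ s₁ := hch.trans hSle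
    have h2 : torusDist (ϑ - π) ≤ π / (2 * B.umin) * s₁ := by
      rw [div_mul_eq_mul_div, le_div_iff₀ (by positivity)]
      calc torusDist (ϑ - π) * (2 * B.umin) = π * (2 * B.umin / π * torusDist (ϑ - π)) := by field_simp
        _ ≤ π * s₁ := mul_le_mul_of_nonneg_left h1 hπ.le
    exact h2.trans hs₁
  exact abs_baseDeriv_partnerBand_pp_le_band_distance_cooper hA hA20 hd hr hlo hhi hA₃ hA₄ hA₅ hA₆ hK₁ hK₂ hK₃ hG hδ₀ hδ₀π hδrow hη₀ hη₀row hϑ θ hρ he v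

end Sizes

end Summit.HubbardSuperconductivity.HubbardSuperconductivity.Theorems.C4a

end
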